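import Literature.Barriers.Schanuel.AlgebraicIndependenceOfLogarithmsRankProofs
import Summits.Schanuel.Schanuel.Statement
import HarnessLib


/-!
# RootDecomp1 — DETERMINANTAL PLACEMENT of the first genuine stratum of piece D
(cell decomp-schanuel · lens-1 «grading / quantitative ladder» · g20 · route `route-Schanuel-RootDecomp1`,
piece D = `DisjointSaturatedEssentialSchanuel`, stmt-Schanuel-30353)

The v4 residue of piece D begins (lens-7 g19, lens-1 g19 `RootDecomp1ConeLadder`) with Cell(2,0) on
NON-RATIONAL surfaces: three `ℚ`-linearly independent logarithms of algebraic numbers `z = (z₀, z₁, z₂)`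
on an ELLIPTIC CONE `{C = 0}`, `C` a smooth ternary cubic form (degree 1 is empty by Baker, degree 2 is
absorbed into piece Q).  This file places the `ℚ`-DETERMINANTAL part of that stratum on Roy's rank ladder
`r ≤ s ≤ 2r` (tree: `Literature.Barriers.Schanuel.structuralRank`,
`roy1995_structuralRank_le_two_mul_rank`, `algIndepLogarithms_predicts_rank_eq_structuralRank`):

* `rank_lt_and_structuralRank_eq_of_det_eq_zero` — GENERAL PLACEMENT: if `A₀, …, A_{n-1}` are rational
  `N × N` matrices whose pencil `∑ Xₖ Aₖ` has a non-singular member, then at every `ℚ`-linearly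
  independent point `z ∈ ℂⁿ` of the determinantal hypersurface `det (∑ zₖ Aₖ) = 0` the matrix
  `M = ∑ zₖ Aₖ` has `rank M < N = structuralRank M`; so `M` violates `r = s`.
* `det_ne_zero_of_rank_eq_structuralRank` — hence the `N × N` instance `RS_N` of "Conjecture 1.1 predicts
  `r = s`" (an explicit hypothesis here, never asserted) excludes every `ℚ`-free logarithmic point from every
  such determinantal hypersurface.
* `conePencil`, `det_conePencil` — the explicit symmetric integer pencil
  `L(X) = [[X₂, 0, X₀], [0, -X₀, X₁], [X₀, X₁, X₂]]`, `det L = X₀³ − X₀X₂² − X₁²X₂`: the cone over the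
  congruent-number curve `Y²Z = X³ − XZ²` (`y² = x³ − x`, conductor 32), non-singular at `X = (1,0,0)`.
* `structuralRank_eq_three`, `rank_eq_two` — UNCONDITIONALLY, a `ℚ`-linearly independent triple on this
  cone gives `M = L(z)` with structural rank `3` and rank exactly `2`; Roy's theorem `s ≤ 2r` reads `3 ≤ 4`
  there (vacuous: the degree-count ceiling of NODE-g20 §3), while `RS₃` (`r = s` for `3 × 3` matrices over
  `𝓛`) says the cell is EMPTY: `congruentCone_free_of_rs33`.  Schanuel gives `RS₃`
  (`rs33_of_schanuel`, via `structuralRank_eq_rank_of_schanuel`), so `congruentCone_free_of_schanuel` is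
  the S-side pin; D 30353 and S hold on the cell vacuously under `RS₃`.
* `affine_point_of_cone` — dehomogenisation: `(z₀/z₂, z₁/z₂)` lies on `y² = x³ − x`.

Honest label (NODE-g20): PLACEMENT, not a decision — `RS₃ ⟹ RS₂ =` four exponentials conjecture, so the
registered statement that empties the cell sits INSIDE the barrier
`Literature/Barriers/Schanuel/AlgebraicIndependenceOfLogarithms.lean` (factor-2 ceiling, Roy 1995 §1
Remark (ii)).  Nothing here is asserted as an axiom; `RS₃` and `Schanuel` occur only as hypotheses.
-/

namespace Summit.Schanuel.Schanuel.Theorems.RootDecomp1DeterminantalPlacement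

open Literature.Barriers.Schanuel

/-! ## Rank of a square matrix through its determinant (folklore helpers) -/

/-- A square matrix over a field with non-zero determinant has full rank. [folklore] -/
theorem rank_eq_of_det_ne_zero {F : Type*} [Field F] {N : ℕ} {M : Matrix (Fin N) (Fin N) F}
    (h : M.det ≠ 0) : M.rank = N := by
  have hU : IsUnit M := (Matrix.isUnit_iff_isUnit_det M).2 (isUnit_iff_ne_zero.2 h)
  rw [Matrix.rank_of_isUnit M hU, Fintype.card_fin]

/-- A square matrix over a field with zero determinant has rank `< N`. [folklore] -/
theorem rank_lt_of_det_eq_zero {F : Type*} [Field F] {N : ℕ} {M : Matrix (Fin N) (Fin N) F}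
    (h : M.det = 0) : M.rank < N := by
  by_contra hlt
  have hr : M.rank = N := le_antisymm (by simpa using M.rank_le_width) (not_lt.1 hlt)
  have hli : LinearIndependent F M.row := by
    rw [linearIndependent_iff_card_eq_finrank_span, Set.finrank, ← Matrix.rank_eq_finrank_span_row,
      hr, Fintype.card_fin]
  exact ((Matrix.isUnit_iff_isUnit_det M).1 (Matrix.linearIndependent_rows_iff_isUnit.1 hli)).ne_zero h

/-! ## General placement: `ℚ`-free points of a `ℚ`-determinantal hypersurface violate `r = s` -/

/-- The entries of `∑ₖ zₖ Aₖ` (`Aₖ` rational) are `ℚ`-linear combinations of the `zₖ`; if every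
`e^{zₖ}` is algebraic they lie in Roy's `𝓛 = logQSpan`. [cite: Roy1995, §1 (Preliminaries)] -/
theorem sum_smul_map_mem_logQSpan {n d l : ℕ} {z : Fin n → ℂ}
    (halg : ∀ k, IsAlgebraic ℚ (Complex.exp (z k))) (A : Fin n → Matrix (Fin d) (Fin l) ℚ)
    (i : Fin d) (j : Fin l) :
    (∑ k, z k • (A k).map (algebraMap ℚ ℂ)) i j ∈ logQSpan := by
  simp only [Matrix.sum_apply, Matrix.smul_apply, Matrix.map_apply, smul_eq_mul]
  refine Submodule.sum_mem _ fun k _ => ?_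
  have hk : z k ∈ logQSpan := Submodule.subset_span (halg k)
  have : z k * algebraMap ℚ ℂ (A k i j) = (A k i j) • z k := by
    rw [Algebra.smul_def, mul_comm]
  rw [this]
  exact Submodule.smul_mem _ _ hk

/-- **General placement.** Let `A₀, …, A_{n-1}` be rational `N × N` matrices whose pencil has a
non-singular member `∑ wₖ Aₖ` (`w ∈ ℂⁿ`).  If `z ∈ ℂⁿ` is `ℚ`-linearly independent and lies on the
determinantal hypersurface `det (∑ zₖ Aₖ) = 0`, then `M = ∑ zₖ Aₖ` has `rank M < N` and
`structuralRank M = N` (the pencil is the minimal `ℚ`-envelope of `M`, tree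
`structuralRank_eq_iSup_rank_of_eq_sum_smul`). [cite: Roy1995, §1 Remark (i) p. 54] -/
theorem rank_lt_and_structuralRank_eq_of_det_eq_zero {n N : ℕ} {z : Fin n → ℂ}
    (hz : LinearIndependent ℚ z) (A : Fin n → Matrix (Fin N) (Fin N) ℚ) (w : Fin n → ℂ)
    (hw : (∑ k, w k • (A k).map (algebraMap ℚ ℂ)).det ≠ 0)
    (hdet : (∑ k, z k • (A k).map (algebraMap ℚ ℂ)).det = 0) :
    (∑ k, z k • (A k).map (algebraMap ℚ ℂ)).rank < N ∧
      structuralRank (∑ k, z k • (A k).map (algebraMap ℚ ℂ)) = N := by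
  refine ⟨rank_lt_of_det_eq_zero hdet, le_antisymm (structuralRank_le_width _) ?_⟩
  have hbdd : BddAbove (Set.range fun v : Fin n → ℂ =>
      (∑ k, v k • (A k).map (algebraMap ℚ ℂ)).rank) :=
    ⟨N, by rintro _ ⟨v, rfl⟩; simpa using Matrix.rank_le_width _⟩
  rw [structuralRank_eq_iSup_rank_of_eq_sum_smul hz A rfl]
  calc N = (∑ k, w k • (A k).map (algebraMap ℚ ℂ)).rank := (rank_eq_of_det_ne_zero hw).symm
    _ ≤ ⨆ v : Fin n → ℂ, (∑ k, v k • (A k).map (algebraMap ℚ ℂ)).rank := le_ciSup hbdd w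

/-- Contrapositive in Roy's language: such an `M` is a matrix with `rank M < structuralRank M`.
[cite: Roy1995, §1 Remark (i) p. 54] -/
theorem rank_lt_structuralRank_of_det_eq_zero {n N : ℕ} {z : Fin n → ℂ}
    (hz : LinearIndependent ℚ z) (A : Fin n → Matrix (Fin N) (Fin N) ℚ) (w : Fin n → ℂ)
    (hw : (∑ k, w k • (A k).map (algebraMap ℚ ℂ)).det ≠ 0)
    (hdet : (∑ k, z k • (A k).map (algebraMap ℚ ℂ)).det = 0) :
    (∑ k, z k • (A k).map (algebraMap ℚ ℂ)).rank <
      structuralRank (∑ k, z k • (A k).map (algebraMap ℚ ℂ)) := by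
  obtain ⟨h1, h2⟩ := rank_lt_and_structuralRank_eq_of_det_eq_zero hz A w hw hdet
  omega

/-- **`RS_N` empties every `ℚ`-determinantal hypersurface cell.** Under the `N × N` instance of
"Conjecture 1.1 predicts `r = s`" — `structuralRank M = rank M` for every `N × N` matrix with entries
in `𝓛` (hypothesis `hRS`; the conclusion of the tree fact
`algIndepLogarithms_predicts_rank_eq_structuralRank` at `d = l = N`) — no `ℚ`-linearly independent tuple
of logarithms of algebraic numbers lies on `det (∑ Xₖ Aₖ) = 0` when the rational pencil has a
non-singular member. [cite: Roy1995, §1 Remark (i) p. 54] -/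
theorem det_ne_zero_of_rank_eq_structuralRank {n N : ℕ}
    (hRS : ∀ M : Matrix (Fin N) (Fin N) ℂ, (∀ i j, M i j ∈ logQSpan) → structuralRank M = M.rank)
    {z : Fin n → ℂ} (hz : LinearIndependent ℚ z) (halg : ∀ k, IsAlgebraic ℚ (Complex.exp (z k)))
    (A : Fin n → Matrix (Fin N) (Fin N) ℚ) (w : Fin n → ℂ)
    (hw : (∑ k, w k • (A k).map (algebraMap ℚ ℂ)).det ≠ 0) :
    (∑ k, z k • (A k).map (algebraMap ℚ ℂ)).det ≠ 0 := by
  intro hdet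
  have h := rank_lt_structuralRank_of_det_eq_zero hz A w hw hdet
  rw [hRS _ (sum_smul_map_mem_logQSpan halg A)] at h
  exact lt_irrefl _ h

/-- Schanuel's conjecture gives `RS_N` for every `N` (tree: `structuralRank_eq_rank_of_schanuel`,
through `AlgIndepLogarithms`). [cite: Roy1995, §1 Remark (i) p. 54] -/
theorem rs_of_schanuel (hS : _root_.Schanuel) (N : ℕ) :
    ∀ M : Matrix (Fin N) (Fin N) ℂ, (∀ i j, M i j ∈ logQSpan) → structuralRank M = M.rank :=
  fun M hM => structuralRank_eq_rank_of_schanuel (fun n => hS n) M hM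

/-! ## The explicit elliptic cone: a symmetric integer pencil over the congruent-number curve -/

/-- The pencil `L(X) = X₀ A₀ + X₁ A₁ + X₂ A₂ = [[X₂, 0, X₀], [0, -X₀, X₁], [X₀, X₁, X₂]]`. -/
def conePencil : Fin 3 → Matrix (Fin 3) (Fin 3) ℚ :=
  ![!![0, 0, 1; 0, -1, 0; 1, 0, 0], !![0, 0, 0; 0, 0, 1; 0, 1, 0], !![1, 0, 0; 0, 0, 0; 0, 0, 1]]

/-- The member of the pencil at `z ∈ ℂ³`, entrywise. -/
theorem sum_smul_conePencil_eq (z : Fin 3 → ℂ) :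
    ∑ k, z k • (conePencil k).map (algebraMap ℚ ℂ) =
      !![z 2, 0, z 0; 0, -z 0, z 1; z 0, z 1, z 2] := by
  ext i j
  fin_cases i <;> fin_cases j <;>
    simp [conePencil, Fin.sum_univ_three, Matrix.sum_apply]

/-- `det L(z) = z₀³ − z₀ z₂² − z₁² z₂` — the cone over `Y²Z = X³ − XZ²`. -/
theorem det_conePencil (z : Fin 3 → ℂ) :
    (∑ k, z k • (conePencil k).map (algebraMap ℚ ℂ)).det =
      z 0 ^ 3 - z 0 * z 2 ^ 2 - z 1 ^ 2 * z 2 := by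
  rw [sum_smul_conePencil_eq, Matrix.det_fin_three]
  simp
  ring

/-- The pencil is non-singular at `X = (1, 0, 0)` (`det = 1`). -/
theorem det_conePencil_witness :
    (∑ k, (![1, 0, 0] : Fin 3 → ℂ) k • (conePencil k).map (algebraMap ℚ ℂ)).det ≠ 0 := by
  rw [det_conePencil]
  simp

/-- **Unconditional placement of the cell.** A `ℚ`-linearly independent `z ∈ ℂ³` on the cone
`z₀³ − z₀z₂² − z₁²z₂ = 0` gives `M = L(z)` of structural rank `3` and rank `≤ 2` — a matrix violating
`r = s`; when moreover `e^{z₀}, e^{z₁}, e^{z₂}` are algebraic, `M ∈ M₃(𝓛)`.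
[cite: Roy1995, §1 Remark (i) p. 54] -/
theorem structuralRank_eq_three {z : Fin 3 → ℂ} (hz : LinearIndependent ℚ z)
    (hcone : z 0 ^ 3 - z 0 * z 2 ^ 2 - z 1 ^ 2 * z 2 = 0) :
    structuralRank (∑ k, z k • (conePencil k).map (algebraMap ℚ ℂ)) = 3 ∧
      (∑ k, z k • (conePencil k).map (algebraMap ℚ ℂ)).rank ≤ 2 := by
  have hdet : (∑ k, z k • (conePencil k).map (algebraMap ℚ ℂ)).det = 0 := by
    rw [det_conePencil, hcone]
  obtain ⟨h1, h2⟩ :=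
    rank_lt_and_structuralRank_eq_of_det_eq_zero hz conePencil _ det_conePencil_witness hdet
  exact ⟨h2, by omega⟩

/-- On the cell the rank is exactly `2` (the minor on rows/columns `{0,1}` is `−z₀z₂ ≠ 0`, a
`ℚ`-linearly independent triple having non-zero coordinates), so Roy's theorem `s ≤ 2r`
(`roy1995_structuralRank_le_two_mul_rank`) reads `3 ≤ 4` there: the half-rank floor is vacuous on
cubic cones. [cite: Roy1995, §1 Corollary 1.3 and Remark (ii) p. 54] -/
theorem rank_eq_two {z : Fin 3 → ℂ} (hz : LinearIndependent ℚ z)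
    (hcone : z 0 ^ 3 - z 0 * z 2 ^ 2 - z 1 ^ 2 * z 2 = 0) :
    (∑ k, z k • (conePencil k).map (algebraMap ℚ ℂ)).rank = 2 := by
  refine le_antisymm (structuralRank_eq_three hz hcone).2 ?_
  by_contra hlt
  have hle : (∑ k, z k • (conePencil k).map (algebraMap ℚ ℂ)).rank ≤ 1 := by omega
  have hminor := det_submatrix_eq_zero_of_rank_le _ hle (![0, 1] : Fin 2 → Fin 3) (![0, 1] : Fin 2 → Fin 3)
  rw [sum_smul_conePencil_eq, Matrix.det_fin_two] at hminor
  simp at hminor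
  rcases hminor with h | h <;> first | exact hz.ne_zero 0 h | exact hz.ne_zero 2 h

/-- **`RS₃` empties the `ℚ`-determinantal elliptic cone.** Under `r = s` for `3 × 3` matrices with
entries in `𝓛`, no `ℚ`-linearly independent triple of logarithms of algebraic numbers lies on the cone
over `Y²Z = X³ − XZ²`; piece D (stmt-Schanuel-30353) and Schanuel's inequality hold on this cell of the
v4 first stratum vacuously. [cite: Roy1995, §1 Remark (i) p. 54] -/
theorem congruentCone_free_of_rs33
    (hRS : ∀ M : Matrix (Fin 3) (Fin 3) ℂ, (∀ i j, M i j ∈ logQSpan) → structuralRank M = M.rank)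
    (z : Fin 3 → ℂ) (hz : LinearIndependent ℚ z) (halg : ∀ k, IsAlgebraic ℚ (Complex.exp (z k))) :
    z 0 ^ 3 - z 0 * z 2 ^ 2 - z 1 ^ 2 * z 2 ≠ 0 := by
  rw [← det_conePencil]
  exact det_ne_zero_of_rank_eq_structuralRank hRS hz halg conePencil _ det_conePencil_witness

/-- S-side pin: Schanuel's conjecture empties the cell (through `RS₃`). -/
theorem congruentCone_free_of_schanuel (hS : _root_.Schanuel)
    (z : Fin 3 → ℂ) (hz : LinearIndependent ℚ z) (halg : ∀ k, IsAlgebraic ℚ (Complex.exp (z k))) :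
    z 0 ^ 3 - z 0 * z 2 ^ 2 - z 1 ^ 2 * z 2 ≠ 0 :=
  congruentCone_free_of_rs33 (rs_of_schanuel hS 3) z hz halg

/-- Vacuous consequence: under `RS₃`, Schanuel's inequality at `n = 3` holds at every `ℚ`-linearly
independent triple of logarithms of algebraic numbers on the cone (there is none). -/
theorem schanuel_ineq_on_congruentCone_of_rs33
    (hRS : ∀ M : Matrix (Fin 3) (Fin 3) ℂ, (∀ i j, M i j ∈ logQSpan) → structuralRank M = M.rank)
    (z : Fin 3 → ℂ) (hz : LinearIndependent ℚ z) (halg : ∀ k, IsAlgebraic ℚ (Complex.exp (z k)))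
    (hcone : z 0 ^ 3 - z 0 * z 2 ^ 2 - z 1 ^ 2 * z 2 = 0) :
    ((3 : ℕ) : Cardinal) ≤ Algebra.trdeg ℚ
      ↥(IntermediateField.adjoin ℚ (Set.range z ∪ Set.range (Complex.exp ∘ z))) :=
  absurd hcone (congruentCone_free_of_rs33 hRS z hz halg)

/-- Dehomogenisation: off `z₂ = 0` the cone point gives the affine point `(z₀/z₂, z₁/z₂)` of the
congruent-number curve `y² = x³ − x` (genus `1`: the first NON-RATIONAL stratum of piece D). -/
theorem affine_point_of_cone {z : Fin 3 → ℂ} (h2 : z 2 ≠ 0)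
    (hcone : z 0 ^ 3 - z 0 * z 2 ^ 2 - z 1 ^ 2 * z 2 = 0) :
    (z 1 / z 2) ^ 2 = (z 0 / z 2) ^ 3 - z 0 / z 2 := by
  field_simp
  linear_combination (-1 : ℂ) * hcone

end Summit.Schanuel.Schanuel.Theorems.RootDecomp1DeterminantalPlacement
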